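import Summits.AtomisticToContinuum.HydrodynamicLimit.Theorems.JParityClosureEvenStressEnskogEnskogIdentificationFields
import Literature.MathematicalPhysics.KineticTheory.MicroscaleWindowFunctionals
import HarnessLib

/-!
# Enskog identification (stub S6b of the line `stationary-microscale-hierarchy-entrance-law`,
# crux `JParityClosure.EvenStressEnskog`, stmt-AtomisticToContinuum-13079) — helper 3:
# integrability of the one-body integrands along good orbits

The `x`-integrands of the one-body functionals `oneBodyStat` / `oneBodyPred` of
`MicroscaleWindowFunctionals.lean`,

* `St(s, w, x) = χ(s,x) k(σ³ρ_r(w,x)) ∫ b_r(y,x) F(v, u_r(w,x), θ_r(w,x)) dμ_w(y,v)`,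
* `Pr(s, w, x) = χ(s,x) k(σ³ρ_r(w,x)) ρ_r(w,x) ∫ F(v, u_r, θ_r) M_{1,θ_r,u_r}(v) dv`,

for continuous `χ`, a continuous weight `k` bounded on `[0, ∞)` and a continuous kernel
`|F(v,u,θ)| ≤ C_F ‖v − u‖²`:

1. joint Borel measurability in `((s, w), x)` (`measurable_oneBodyStatIntegrand_prod`,
   `measurable_oneBodyPredIntegrand_prod`), via the finite-sum form of the empirical average and the
   Fubini measurability of the Maxwellian pairing;
2. the sup bounds `|St|, |Pr| ≤ C_χ C_k · 2C_F (3/πr³) E(w)/(N+1)` (`abs_oneBodyStatIntegrand_le`,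
   `abs_oneBodyPredIntegrand_le`: the peculiar second moment is `≤ 2e_r`, the Maxwellian second moment is
   `3θ_r` with `ρ_rθ_r ≤ (2/3)e_r`, and `e_r ≤ (3/πr³)E/(N+1)`), hence integrability over `𝕋³`
   (`integrable_oneBodyStatIntegrand`, `integrable_oneBodyPredIntegrand`) and the same bounds for the
   `x`-integrals;
3. integrability in time on `[0, τ]` of the `x`-integrals along a good orbit
   (`integrableOn_oneBodyStat_flow`, `integrableOn_oneBodyPred_flow`), the bound being uniform in `s` by
   conservation of the kinetic energy (`HardSphereFlow.configEnergy_flow`) — the pattern of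
   `EvenStatTruncationBound.integrableOn_enskogRate_flow`.

The file ends with the registered Tools sub-stub `stub_enskogIdentificationIntegrableTools` (item 3), so
that it rides with `stub_enskogIdentification_of_pointwise`.

References: H. Spohn, *Large Scale Dynamics of Interacting Particles* (1991), Part I §3.2;
C. Cercignani, R. Illner, M. Pulvirenti (1994) §4.2 (good set, energy conservation).
-/

noncomputable section

open scoped BigOperators InnerProductSpace Topology ENNReal
open MeasureTheory Filter Set
open Literature.MathematicalPhysics.KineticTheory Literature.Analysis.FluidPDE

namespace Summit.AtomisticToContinuum.HydrodynamicLimit.Theorems.EvenStressEnskog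

variable {N : ℕ}

/-! ## Joint measurability -/

/-- **The `oneBodyStat` integrand is jointly Borel in `((s, w), x)`** (finite empirical sum of
continuous / measurable pieces). [folklore] -/
theorem measurable_oneBodyStatIntegrand_prod (σ r : ℝ) {χ : ℝ × T3 → ℝ} (hχ : Continuous χ)
    {k : ℝ → ℝ} (hk : Continuous k) {F : V3 × V3 × ℝ → ℝ} (hF : Continuous F) :
    Measurable fun q : (ℝ × Config (N + 1) (Fin 3) T3) × T3 =>
      χ (q.1.1, q.2) * k (σ ^ 3 * mollDensity r q.1.2 q.2) *
        ∫ p, coneKernel r p.1 q.2 *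
            F (p.2, KineticEntropyBalance.uC r q.1.2 q.2, mollTemperature r q.1.2 q.2)
          ∂(empiricalMeasure q.1.2) := by
  have h : (fun q : (ℝ × Config (N + 1) (Fin 3) T3) × T3 =>
      χ (q.1.1, q.2) * k (σ ^ 3 * mollDensity r q.1.2 q.2) *
        ∫ p, coneKernel r p.1 q.2 *
            F (p.2, KineticEntropyBalance.uC r q.1.2 q.2, mollTemperature r q.1.2 q.2)
          ∂(empiricalMeasure q.1.2)) =
      fun q => χ (q.1.1, q.2) * k (σ ^ 3 * mollDensity r q.1.2 q.2) *
        (((N + 1 : ℕ) : ℝ)⁻¹ * ∑ i, coneKernel r (q.1.2 i).1 q.2 *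
          F ((q.1.2 i).2, KineticEntropyBalance.uC r q.1.2 q.2, mollTemperature r q.1.2 q.2)) := by
    funext q
    rw [integral_empiricalMeasure]
  rw [h]
  have hf : Measurable fun q : (ℝ × Config (N + 1) (Fin 3) T3) × T3 => q.1.2 := measurable_fst.snd
  have hρ := measurable_mollDensity_comp r hf measurable_snd
  have hu := measurable_uC_comp r hf measurable_snd
  have hθ := measurable_mollTemperature_comp r hf measurable_snd
  refine (((hχ.measurable.comp (measurable_fst.fst.prodMk measurable_snd)).mul
    (hk.measurable.comp (hρ.const_mul _))).mul (measurable_const.mul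
      (Finset.measurable_sum _ fun i _ => ?_)))
  exact (measurable_coneKernel_comp r ((measurable_pi_apply i).comp hf).fst measurable_snd).mul
    (hF.measurable.comp (((measurable_pi_apply i).comp hf).snd.prodMk (hu.prodMk hθ)))

/-- **The `oneBodyPred` integrand is jointly Borel in `((s, w), x)`** (the Maxwellian pairing is Borel in
its parameters, `measurable_integral_mul_localMaxwellian`). [folklore] -/
theorem measurable_oneBodyPredIntegrand_prod (σ r : ℝ) {χ : ℝ × T3 → ℝ} (hχ : Continuous χ)
    {k : ℝ → ℝ} (hk : Continuous k) {F : V3 × V3 × ℝ → ℝ} (hF : Continuous F) :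
    Measurable fun q : (ℝ × Config (N + 1) (Fin 3) T3) × T3 =>
      χ (q.1.1, q.2) * k (σ ^ 3 * mollDensity r q.1.2 q.2) * mollDensity r q.1.2 q.2 *
        ∫ v, F (v, KineticEntropyBalance.uC r q.1.2 q.2, mollTemperature r q.1.2 q.2) *
          localMaxwellian 1 (mollTemperature r q.1.2 q.2) (KineticEntropyBalance.uC r q.1.2 q.2) v := by
  have hf : Measurable fun q : (ℝ × Config (N + 1) (Fin 3) T3) × T3 => q.1.2 := measurable_fst.snd
  have hρ := measurable_mollDensity_comp r hf measurable_snd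
  have hu := measurable_uC_comp r hf measurable_snd
  have hθ := measurable_mollTemperature_comp r hf measurable_snd
  exact ((((hχ.measurable.comp (measurable_fst.fst.prodMk measurable_snd)).mul
    (hk.measurable.comp (hρ.const_mul _))).mul hρ).mul
      ((measurable_integral_mul_localMaxwellian hF).comp (hu.prodMk hθ)))

/-! ## Sup bounds -/

/-- The empirical pairing of the quadratic kernel is controlled by the kinetic energy:
`|∫ b_r(y,x) F(v, u_r, θ_r) dμ_w| ≤ 2 C_F (3/πr³) E(w)/(N+1)`. [folklore] -/
theorem abs_integral_coneKernel_mul_le {r : ℝ} (hr : 0 < r) {F : V3 × V3 × ℝ → ℝ} {CF : ℝ}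
    (hCF : 0 ≤ CF) (hFb : ∀ v u θ, |F (v, u, θ)| ≤ CF * ‖v - u‖ ^ 2) (w : Config (N + 1) (Fin 3) T3)
    (x : T3) :
    |∫ p, coneKernel r p.1 x * F (p.2, KineticEntropyBalance.uC r w x, mollTemperature r w x)
        ∂(empiricalMeasure w)| ≤
      2 * CF * (3 / (Real.pi * r ^ 3)) * (configEnergy w / ((N + 1 : ℕ) : ℝ)) := by
  rw [integral_empiricalMeasure, abs_mul, abs_of_nonneg (inv_nonneg.2 (Nat.cast_nonneg _))]
  have hterm : ∀ i : Fin (N + 1),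
      |coneKernel r (w i).1 x * F ((w i).2, KineticEntropyBalance.uC r w x, mollTemperature r w x)| ≤
        CF * (coneKernel r (w i).1 x * ‖(w i).2 - KineticEntropyBalance.uC r w x‖ ^ 2) := fun i => by
    have hb := (coneKernel_mem_Icc hr (w i).1 x).1
    rw [abs_mul, abs_of_nonneg hb]
    calc coneKernel r (w i).1 x * |F ((w i).2, KineticEntropyBalance.uC r w x, mollTemperature r w x)|
        ≤ coneKernel r (w i).1 x * (CF * ‖(w i).2 - KineticEntropyBalance.uC r w x‖ ^ 2) :=
          mul_le_mul_of_nonneg_left (hFb _ _ _) hb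
      _ = _ := by ring
  calc ((N + 1 : ℕ) : ℝ)⁻¹ *
        |∑ i, coneKernel r (w i).1 x * F ((w i).2, KineticEntropyBalance.uC r w x, mollTemperature r w x)|
      ≤ ((N + 1 : ℕ) : ℝ)⁻¹ *
          ∑ i, CF * (coneKernel r (w i).1 x * ‖(w i).2 - KineticEntropyBalance.uC r w x‖ ^ 2) :=
        mul_le_mul_of_nonneg_left ((Finset.abs_sum_le_sum_abs _ _).trans (Finset.sum_le_sum fun i _ => hterm i))
          (inv_nonneg.2 (Nat.cast_nonneg _))
    _ = CF * (((N + 1 : ℕ) : ℝ)⁻¹ *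
          ∑ i, coneKernel r (w i).1 x * ‖(w i).2 - KineticEntropyBalance.uC r w x‖ ^ 2) := by
        rw [← Finset.mul_sum]; ring
    _ ≤ CF * (2 * mollKineticEnergy r w x) :=
        mul_le_mul_of_nonneg_left (avg_coneKernel_mul_norm_sub_uC_sq_le hr w x) hCF
    _ ≤ CF * (2 * (3 / (Real.pi * r ^ 3) * (configEnergy w / ((N + 1 : ℕ) : ℝ)))) :=
        mul_le_mul_of_nonneg_left (mul_le_mul_of_nonneg_left (mollKineticEnergy_le hr w x) zero_le_two) hCF
    _ = _ := by ring

/-- The Maxwellian pairing weighted by the density is controlled by the kinetic energy: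
`|ρ_r ∫ F(v, u_r, θ_r) M_{1,θ_r,u_r}(v) dv| ≤ 2 C_F (3/πr³) E(w)/(N+1)`. [folklore] -/
theorem abs_mollDensity_mul_integral_le {r : ℝ} (hr : 0 < r) {F : V3 × V3 × ℝ → ℝ} {CF : ℝ}
    (hCF : 0 ≤ CF) (hFb : ∀ v u θ, |F (v, u, θ)| ≤ CF * ‖v - u‖ ^ 2) (w : Config (N + 1) (Fin 3) T3)
    (x : T3) :
    |mollDensity r w x *
        ∫ v, F (v, KineticEntropyBalance.uC r w x, mollTemperature r w x) *
          localMaxwellian 1 (mollTemperature r w x) (KineticEntropyBalance.uC r w x) v| ≤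
      2 * CF * (3 / (Real.pi * r ^ 3)) * (configEnergy w / ((N + 1 : ℕ) : ℝ)) := by
  have hρ0 : 0 ≤ mollDensity r w x := mollDensity_nonneg_of_pos hr w x
  have he := mollKineticEnergy_le hr w x
  have hρθ := mollDensity_mul_mollTemperature_le hr w x
  have hG := abs_integral_mul_localMaxwellian_le hFb (KineticEntropyBalance.uC r w x) (mollTemperature r w x)
  rw [abs_mul, abs_of_nonneg hρ0]
  have hmax : mollDensity r w x * max (mollTemperature r w x) 0 ≤ 2 / 3 * mollKineticEnergy r w x := by
    rcases le_or_gt (mollTemperature r w x) 0 with hθ | hθ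
    · rw [max_eq_right hθ, mul_zero]
      exact mul_nonneg (by norm_num) (mollKineticEnergy_nonneg hr w x)
    · rwa [max_eq_left hθ.le]
  calc mollDensity r w x *
        |∫ v, F (v, KineticEntropyBalance.uC r w x, mollTemperature r w x) *
          localMaxwellian 1 (mollTemperature r w x) (KineticEntropyBalance.uC r w x) v|
      ≤ mollDensity r w x * (3 * CF * max (mollTemperature r w x) 0) := mul_le_mul_of_nonneg_left hG hρ0
    _ = 3 * CF * (mollDensity r w x * max (mollTemperature r w x) 0) := by ring
    _ ≤ 3 * CF * (2 / 3 * mollKineticEnergy r w x) := mul_le_mul_of_nonneg_left hmax (by positivity)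
    _ ≤ 3 * CF * (2 / 3 * (3 / (Real.pi * r ^ 3) * (configEnergy w / ((N + 1 : ℕ) : ℝ)))) :=
        mul_le_mul_of_nonneg_left (mul_le_mul_of_nonneg_left he (by norm_num)) (by positivity)
    _ = _ := by ring

/-- **Sup bound of the `oneBodyStat` integrand**: `|St(s,w,x)| ≤ C_χ C_k · 2C_F(3/πr³)E(w)/(N+1)` when
`|χ(s,·)| ≤ C_χ`, `|k| ≤ C_k` on `[0, ∞)` (`σ ≥ 0`, `r > 0`). [folklore] -/
theorem abs_oneBodyStatIntegrand_le {σ r : ℝ} (hσ : 0 ≤ σ) (hr : 0 < r) {χ : ℝ × T3 → ℝ} {k : ℝ → ℝ}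
    {s Cχ Ck : ℝ} (hχb : ∀ x, |χ (s, x)| ≤ Cχ) (hkb : ∀ a, 0 ≤ a → |k a| ≤ Ck)
    {F : V3 × V3 × ℝ → ℝ} {CF : ℝ} (hCF : 0 ≤ CF) (hFb : ∀ v u θ, |F (v, u, θ)| ≤ CF * ‖v - u‖ ^ 2)
    (w : Config (N + 1) (Fin 3) T3) (x : T3) :
    |χ (s, x) * k (σ ^ 3 * mollDensity r w x) *
        ∫ p, coneKernel r p.1 x * F (p.2, KineticEntropyBalance.uC r w x, mollTemperature r w x)
          ∂(empiricalMeasure w)| ≤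
      Cχ * Ck * (2 * CF * (3 / (Real.pi * r ^ 3)) * (configEnergy w / ((N + 1 : ℕ) : ℝ))) := by
  have hCχ0 : 0 ≤ Cχ := (abs_nonneg _).trans (hχb x)
  have ha : 0 ≤ σ ^ 3 * mollDensity r w x := mul_nonneg (pow_nonneg hσ 3) (mollDensity_nonneg_of_pos hr w x)
  rw [abs_mul, abs_mul]
  exact mul_le_mul (mul_le_mul (hχb x) (hkb _ ha) (abs_nonneg _) hCχ0)
    (abs_integral_coneKernel_mul_le hr hCF hFb w x) (abs_nonneg _)
    (mul_nonneg hCχ0 ((abs_nonneg _).trans (hkb _ ha)))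

/-- **Sup bound of the `oneBodyPred` integrand**: `|Pr(s,w,x)| ≤ C_χ C_k · 2C_F(3/πr³)E(w)/(N+1)`.
[folklore] -/
theorem abs_oneBodyPredIntegrand_le {σ r : ℝ} (hσ : 0 ≤ σ) (hr : 0 < r) {χ : ℝ × T3 → ℝ} {k : ℝ → ℝ}
    {s Cχ Ck : ℝ} (hχb : ∀ x, |χ (s, x)| ≤ Cχ) (hkb : ∀ a, 0 ≤ a → |k a| ≤ Ck)
    {F : V3 × V3 × ℝ → ℝ} {CF : ℝ} (hCF : 0 ≤ CF) (hFb : ∀ v u θ, |F (v, u, θ)| ≤ CF * ‖v - u‖ ^ 2)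
    (w : Config (N + 1) (Fin 3) T3) (x : T3) :
    |χ (s, x) * k (σ ^ 3 * mollDensity r w x) * mollDensity r w x *
        ∫ v, F (v, KineticEntropyBalance.uC r w x, mollTemperature r w x) *
          localMaxwellian 1 (mollTemperature r w x) (KineticEntropyBalance.uC r w x) v| ≤
      Cχ * Ck * (2 * CF * (3 / (Real.pi * r ^ 3)) * (configEnergy w / ((N + 1 : ℕ) : ℝ))) := by
  have hCχ0 : 0 ≤ Cχ := (abs_nonneg _).trans (hχb x)
  have ha : 0 ≤ σ ^ 3 * mollDensity r w x := mul_nonneg (pow_nonneg hσ 3) (mollDensity_nonneg_of_pos hr w x)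
  rw [mul_assoc (χ (s, x) * k (σ ^ 3 * mollDensity r w x)), abs_mul, abs_mul]
  exact mul_le_mul (mul_le_mul (hχb x) (hkb _ ha) (abs_nonneg _) hCχ0)
    (abs_mollDensity_mul_integral_le hr hCF hFb w x) (abs_nonneg _)
    (mul_nonneg hCχ0 ((abs_nonneg _).trans (hkb _ ha)))

/-! ## Integrability over `𝕋³` and bounds of the `x`-integrals -/

/-- A continuous `χ` is bounded on each time slice of the compact torus. [folklore] -/
theorem exists_abs_slice_le {χ : ℝ × T3 → ℝ} (hχ : Continuous χ) (s : ℝ) :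
    ∃ Cχ : ℝ, ∀ x, |χ (s, x)| ≤ Cχ := by
  have hχc : Continuous fun x : T3 => χ (s, x) := hχ.comp (continuous_const.prodMk continuous_id)
  obtain ⟨Cχ, hCχ⟩ := isCompact_univ.exists_bound_of_continuousOn hχc.continuousOn
  exact ⟨Cχ, fun x => by simpa only [Real.norm_eq_abs] using hCχ x (mem_univ x)⟩

/-- A continuous `χ` is bounded on `[0, τ] × 𝕋³`. [folklore] -/
theorem exists_abs_le_on_Icc {χ : ℝ × T3 → ℝ} (hχ : Continuous χ) (τ : ℝ) :
    ∃ Cχ : ℝ, ∀ s ∈ Icc (0 : ℝ) τ, ∀ x, |χ (s, x)| ≤ Cχ := by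
  have hK : IsCompact (Icc (0 : ℝ) τ ×ˢ (univ : Set T3)) := isCompact_Icc.prod isCompact_univ
  obtain ⟨Cχ, hCχ⟩ := hK.exists_bound_of_continuousOn hχ.continuousOn
  exact ⟨Cχ, fun s hs x => by simpa only [Real.norm_eq_abs] using hCχ (s, x) ⟨hs, mem_univ x⟩⟩

/-- **The `oneBodyStat` integrand is integrable over `𝕋³`** (measurable and bounded). [folklore] -/
theorem integrable_oneBodyStatIntegrand {σ r : ℝ} (hσ : 0 ≤ σ) (hr : 0 < r) {χ : ℝ × T3 → ℝ}
    (hχ : Continuous χ) {k : ℝ → ℝ} (hk : Continuous k) {Ck : ℝ} (hkb : ∀ a, 0 ≤ a → |k a| ≤ Ck)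
    {F : V3 × V3 × ℝ → ℝ} (hF : Continuous F) {CF : ℝ} (hCF : 0 ≤ CF)
    (hFb : ∀ v u θ, |F (v, u, θ)| ≤ CF * ‖v - u‖ ^ 2) (s : ℝ) (w : Config (N + 1) (Fin 3) T3) :
    Integrable fun x => χ (s, x) * k (σ ^ 3 * mollDensity r w x) *
      ∫ p, coneKernel r p.1 x * F (p.2, KineticEntropyBalance.uC r w x, mollTemperature r w x)
        ∂(empiricalMeasure w) := by
  obtain ⟨Cχ, hχb⟩ := exists_abs_slice_le hχ s
  have hmeas := (measurable_oneBodyStatIntegrand_prod σ r hχ hk hF).comp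
    (measurable_prodMk_left (x := ((s, w) : ℝ × Config (N + 1) (Fin 3) T3)))
  refine Integrable.of_bound hmeas.aestronglyMeasurable
    (Cχ * Ck * (2 * CF * (3 / (Real.pi * r ^ 3)) * (configEnergy w / ((N + 1 : ℕ) : ℝ))))
    (ae_of_all _ fun x => ?_)
  rw [Real.norm_eq_abs]
  exact abs_oneBodyStatIntegrand_le hσ hr hχb hkb hCF hFb w x

/-- **The `oneBodyPred` integrand is integrable over `𝕋³`** (measurable and bounded). [folklore] -/
theorem integrable_oneBodyPredIntegrand {σ r : ℝ} (hσ : 0 ≤ σ) (hr : 0 < r) {χ : ℝ × T3 → ℝ}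
    (hχ : Continuous χ) {k : ℝ → ℝ} (hk : Continuous k) {Ck : ℝ} (hkb : ∀ a, 0 ≤ a → |k a| ≤ Ck)
    {F : V3 × V3 × ℝ → ℝ} (hF : Continuous F) {CF : ℝ} (hCF : 0 ≤ CF)
    (hFb : ∀ v u θ, |F (v, u, θ)| ≤ CF * ‖v - u‖ ^ 2) (s : ℝ) (w : Config (N + 1) (Fin 3) T3) :
    Integrable fun x => χ (s, x) * k (σ ^ 3 * mollDensity r w x) * mollDensity r w x *
      ∫ v, F (v, KineticEntropyBalance.uC r w x, mollTemperature r w x) *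
        localMaxwellian 1 (mollTemperature r w x) (KineticEntropyBalance.uC r w x) v := by
  obtain ⟨Cχ, hχb⟩ := exists_abs_slice_le hχ s
  have hmeas := (measurable_oneBodyPredIntegrand_prod σ r hχ hk hF).comp
    (measurable_prodMk_left (x := ((s, w) : ℝ × Config (N + 1) (Fin 3) T3)))
  refine Integrable.of_bound hmeas.aestronglyMeasurable
    (Cχ * Ck * (2 * CF * (3 / (Real.pi * r ^ 3)) * (configEnergy w / ((N + 1 : ℕ) : ℝ))))
    (ae_of_all _ fun x => ?_)
  rw [Real.norm_eq_abs]
  exact abs_oneBodyPredIntegrand_le hσ hr hχb hkb hCF hFb w x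

/-- Bound of the `x`-integral of the `oneBodyStat` integrand (no integrability needed; `vol 𝕋³ = 1`).
[folklore] -/
theorem abs_integral_oneBodyStatIntegrand_le {σ r : ℝ} (hσ : 0 ≤ σ) (hr : 0 < r) {χ : ℝ × T3 → ℝ}
    {k : ℝ → ℝ} {s Cχ Ck : ℝ} (hχb : ∀ x, |χ (s, x)| ≤ Cχ) (hkb : ∀ a, 0 ≤ a → |k a| ≤ Ck)
    {F : V3 × V3 × ℝ → ℝ} {CF : ℝ} (hCF : 0 ≤ CF) (hFb : ∀ v u θ, |F (v, u, θ)| ≤ CF * ‖v - u‖ ^ 2)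
    (w : Config (N + 1) (Fin 3) T3) :
    |∫ x, χ (s, x) * k (σ ^ 3 * mollDensity r w x) *
        ∫ p, coneKernel r p.1 x * F (p.2, KineticEntropyBalance.uC r w x, mollTemperature r w x)
          ∂(empiricalMeasure w)| ≤
      Cχ * Ck * (2 * CF * (3 / (Real.pi * r ^ 3)) * (configEnergy w / ((N + 1 : ℕ) : ℝ))) := by
  have hb : ∀ x, ‖χ (s, x) * k (σ ^ 3 * mollDensity r w x) *
      ∫ p, coneKernel r p.1 x * F (p.2, KineticEntropyBalance.uC r w x, mollTemperature r w x)
        ∂(empiricalMeasure w)‖ ≤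
      Cχ * Ck * (2 * CF * (3 / (Real.pi * r ^ 3)) * (configEnergy w / ((N + 1 : ℕ) : ℝ))) := fun x => by
    rw [Real.norm_eq_abs]; exact abs_oneBodyStatIntegrand_le hσ hr hχb hkb hCF hFb w x
  have h := norm_integral_le_of_norm_le_const (μ := (volume : Measure T3)) (ae_of_all _ hb)
  rwa [Real.norm_eq_abs, show (volume : Measure T3).real univ = 1 from probReal_univ, mul_one] at h

/-- Bound of the `x`-integral of the `oneBodyPred` integrand. [folklore] -/
theorem abs_integral_oneBodyPredIntegrand_le {σ r : ℝ} (hσ : 0 ≤ σ) (hr : 0 < r) {χ : ℝ × T3 → ℝ}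
    {k : ℝ → ℝ} {s Cχ Ck : ℝ} (hχb : ∀ x, |χ (s, x)| ≤ Cχ) (hkb : ∀ a, 0 ≤ a → |k a| ≤ Ck)
    {F : V3 × V3 × ℝ → ℝ} {CF : ℝ} (hCF : 0 ≤ CF) (hFb : ∀ v u θ, |F (v, u, θ)| ≤ CF * ‖v - u‖ ^ 2)
    (w : Config (N + 1) (Fin 3) T3) :
    |∫ x, χ (s, x) * k (σ ^ 3 * mollDensity r w x) * mollDensity r w x *
        ∫ v, F (v, KineticEntropyBalance.uC r w x, mollTemperature r w x) *
          localMaxwellian 1 (mollTemperature r w x) (KineticEntropyBalance.uC r w x) v| ≤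
      Cχ * Ck * (2 * CF * (3 / (Real.pi * r ^ 3)) * (configEnergy w / ((N + 1 : ℕ) : ℝ))) := by
  have hb : ∀ x, ‖χ (s, x) * k (σ ^ 3 * mollDensity r w x) * mollDensity r w x *
      ∫ v, F (v, KineticEntropyBalance.uC r w x, mollTemperature r w x) *
        localMaxwellian 1 (mollTemperature r w x) (KineticEntropyBalance.uC r w x) v‖ ≤
      Cχ * Ck * (2 * CF * (3 / (Real.pi * r ^ 3)) * (configEnergy w / ((N + 1 : ℕ) : ℝ))) := fun x => by
    rw [Real.norm_eq_abs]; exact abs_oneBodyPredIntegrand_le hσ hr hχb hkb hCF hFb w x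
  have h := norm_integral_le_of_norm_le_const (μ := (volume : Measure T3)) (ae_of_all _ hb)
  rwa [Real.norm_eq_abs, show (volume : Measure T3).real univ = 1 from probReal_univ, mul_one] at h

/-! ## Along good orbits -/

/-- **The `x`-integral of the `oneBodyStat` integrand is integrable in time along a good orbit** on
`[0, τ]`: measurable in `s` (Fubini measurability composed with the measurable orbit) and bounded by the
conserved kinetic energy. [folklore] -/
theorem integrableOn_oneBodyStat_flow {σ : ℝ} (hσ : 0 ≤ σ)
    (Φ : HardSphereFlow (Torus.geometry (Fin 3)) (hsDiameter σ N) (N + 1))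
    {z : Config (N + 1) (Fin 3) T3} (hz : z ∈ Φ.good) {r : ℝ} (hr : 0 < r) {χ : ℝ × T3 → ℝ}
    (hχ : Continuous χ) {k : ℝ → ℝ} (hk : Continuous k) {Ck : ℝ} (hkb : ∀ a, 0 ≤ a → |k a| ≤ Ck)
    {F : V3 × V3 × ℝ → ℝ} (hF : Continuous F) {CF : ℝ} (hCF : 0 ≤ CF)
    (hFb : ∀ v u θ, |F (v, u, θ)| ≤ CF * ‖v - u‖ ^ 2) (τ : ℝ) :
    IntegrableOn (fun s => ∫ x, χ (s, x) * k (σ ^ 3 * mollDensity r (Φ.flow s z) x) *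
      ∫ p, coneKernel r p.1 x *
          F (p.2, KineticEntropyBalance.uC r (Φ.flow s z) x, mollTemperature r (Φ.flow s z) x)
        ∂(empiricalMeasure (Φ.flow s z))) (Icc 0 τ) := by
  obtain ⟨Cχ, hχb⟩ := exists_abs_le_on_Icc hχ τ
  have hmeas : Measurable fun s => ∫ x, χ (s, x) * k (σ ^ 3 * mollDensity r (Φ.flow s z) x) *
      ∫ p, coneKernel r p.1 x *
          F (p.2, KineticEntropyBalance.uC r (Φ.flow s z) x, mollTemperature r (Φ.flow s z) x)
        ∂(empiricalMeasure (Φ.flow s z)) :=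
    ((measurable_oneBodyStatIntegrand_prod σ r hχ hk hF).stronglyMeasurable.integral_prod_right'
      (ν := volume)).measurable.comp (measurable_id.prodMk (measurable_flow_of_mem_good Φ hz))
  refine Integrable.of_bound hmeas.aestronglyMeasurable
    (Cχ * Ck * (2 * CF * (3 / (Real.pi * r ^ 3)) * (configEnergy z / ((N + 1 : ℕ) : ℝ)))) ?_
  filter_upwards [ae_restrict_mem measurableSet_Icc] with s hs
  rw [Real.norm_eq_abs, ← Φ.configEnergy_flow hz s]
  exact abs_integral_oneBodyStatIntegrand_le hσ hr (hχb s hs) hkb hCF hFb _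

/-- **The `x`-integral of the `oneBodyPred` integrand is integrable in time along a good orbit** on
`[0, τ]`. [folklore] -/
theorem integrableOn_oneBodyPred_flow {σ : ℝ} (hσ : 0 ≤ σ)
    (Φ : HardSphereFlow (Torus.geometry (Fin 3)) (hsDiameter σ N) (N + 1))
    {z : Config (N + 1) (Fin 3) T3} (hz : z ∈ Φ.good) {r : ℝ} (hr : 0 < r) {χ : ℝ × T3 → ℝ}
    (hχ : Continuous χ) {k : ℝ → ℝ} (hk : Continuous k) {Ck : ℝ} (hkb : ∀ a, 0 ≤ a → |k a| ≤ Ck)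
    {F : V3 × V3 × ℝ → ℝ} (hF : Continuous F) {CF : ℝ} (hCF : 0 ≤ CF)
    (hFb : ∀ v u θ, |F (v, u, θ)| ≤ CF * ‖v - u‖ ^ 2) (τ : ℝ) :
    IntegrableOn (fun s => ∫ x, χ (s, x) * k (σ ^ 3 * mollDensity r (Φ.flow s z) x) *
      mollDensity r (Φ.flow s z) x *
      ∫ v, F (v, KineticEntropyBalance.uC r (Φ.flow s z) x, mollTemperature r (Φ.flow s z) x) *
        localMaxwellian 1 (mollTemperature r (Φ.flow s z) x)
          (KineticEntropyBalance.uC r (Φ.flow s z) x) v) (Icc 0 τ) := by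
  obtain ⟨Cχ, hχb⟩ := exists_abs_le_on_Icc hχ τ
  have hmeas : Measurable fun s => ∫ x, χ (s, x) * k (σ ^ 3 * mollDensity r (Φ.flow s z) x) *
      mollDensity r (Φ.flow s z) x *
      ∫ v, F (v, KineticEntropyBalance.uC r (Φ.flow s z) x, mollTemperature r (Φ.flow s z) x) *
        localMaxwellian 1 (mollTemperature r (Φ.flow s z) x)
          (KineticEntropyBalance.uC r (Φ.flow s z) x) v :=
    ((measurable_oneBodyPredIntegrand_prod σ r hχ hk hF).stronglyMeasurable.integral_prod_right'
      (ν := volume)).measurable.comp (measurable_id.prodMk (measurable_flow_of_mem_good Φ hz))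
  refine Integrable.of_bound hmeas.aestronglyMeasurable
    (Cχ * Ck * (2 * CF * (3 / (Real.pi * r ^ 3)) * (configEnergy z / ((N + 1 : ℕ) : ℝ)))) ?_
  filter_upwards [ae_restrict_mem measurableSet_Icc] with s hs
  rw [Real.norm_eq_abs, ← Φ.configEnergy_flow hz s]
  exact abs_integral_oneBodyPredIntegrand_le hσ hr (hχb s hs) hkb hCF hFb _


/-! ## Registered Tools sub-stub -/

/-- **Tools sub-stub of the Enskog identification (S6b), integrability part** — registered on the crux item
so that this helper file rides with `stub_enskogIdentification_of_pointwise`: along a good orbit the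
`x`-integrals of the `oneBodyStat` and `oneBodyPred` integrands are integrable in time on `[0, τ]`, for a
continuous `χ`, a continuous weight bounded on `[0, ∞)` and a continuous quadratic kernel. [folklore] -/
theorem stub_enskogIdentificationIntegrableTools :
    ∀ (N : ℕ) (σ : ℝ), 0 ≤ σ →
    ∀ (Φ : HardSphereFlow (Torus.geometry (Fin 3)) (hsDiameter σ N) (N + 1)) (z : Config (N + 1) (Fin 3) T3),
    z ∈ Φ.good → ∀ r : ℝ, 0 < r → ∀ χ : ℝ × T3 → ℝ, Continuous χ →
    ∀ k : ℝ → ℝ, Continuous k → (∃ Ck : ℝ, ∀ a, 0 ≤ a → |k a| ≤ Ck) →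
    ∀ F : V3 × V3 × ℝ → ℝ, Continuous F → (∃ CF : ℝ, 0 ≤ CF ∧ ∀ (v u : V3) (θ : ℝ), |F (v, u, θ)| ≤ CF * ‖v - u‖ ^ 2) →
    ∀ τ : ℝ,
      IntegrableOn (fun s => ∫ x, χ (s, x) * k (σ ^ 3 * mollDensity r (Φ.flow s z) x) *
        ∫ p, coneKernel r p.1 x *
            F (p.2, KineticEntropyBalance.uC r (Φ.flow s z) x, mollTemperature r (Φ.flow s z) x)
          ∂(empiricalMeasure (Φ.flow s z))) (Set.Icc 0 τ) ∧
      IntegrableOn (fun s => ∫ x, χ (s, x) * k (σ ^ 3 * mollDensity r (Φ.flow s z) x) *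
        mollDensity r (Φ.flow s z) x *
        ∫ v, F (v, KineticEntropyBalance.uC r (Φ.flow s z) x, mollTemperature r (Φ.flow s z) x) *
          localMaxwellian 1 (mollTemperature r (Φ.flow s z) x)
            (KineticEntropyBalance.uC r (Φ.flow s z) x) v) (Set.Icc 0 τ) := by
  intro N σ hσ Φ z hz r hr χ hχ k hk hkb F hF hFb τ
  obtain ⟨Ck, hkb⟩ := hkb
  obtain ⟨CF, hCF, hFb⟩ := hFb
  exact ⟨integrableOn_oneBodyStat_flow hσ Φ hz hr hχ hk hkb hF hCF hFb τ,
    integrableOn_oneBodyPred_flow hσ Φ hz hr hχ hk hkb hF hCF hFb τ⟩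

end Summit.AtomisticToContinuum.HydrodynamicLimit.Theorems.EvenStressEnskog

end
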